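import Literature.NumberTheory.EllipticCurves.ZpCorankStable
import Literature.NumberTheory.EllipticCurves.BSDSelmerParityDokchitserBaseChangeProofs
import HarnessLib

/-!
# Crux V2 `KolyvaginCorankRigidityAtTwo` (stmt-BirchSwinnertonDyer-23949), line `kolyvagin-depth-split`,
# stub `stub_lowerBoundMinimalPosDepth`: the TERMINAL step — coranks from finite levels

Kolyvagin's lower bound `r^{(f+1)} ≥ f + 1` (Math. Ann. 291 (1991), Thm. 2.2–2.3; W. Zhang 2014,
Lemma 8.4 (2)) is obtained by exhibiting, for every level `M`, `f + 1` Selmer classes of order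
`~ p^M` which are independent modulo a bounded defect (the upper-triangular localisation matrix),
and then reading the `ℤ_p`-corank off the growth `#Sel[p^M] ≫ p^{(f+1)M}`. This file proves that
last, purely algebraic, step once and for all (any prime `p`, so in particular `p = 2`, where the
bounded defects of the prime `2` — one inflated class, one bit per local pairing — are absorbed by
the constant `C`):

* `natCard_torsionBy_pow_le_pow` — `#A[p^M] ≤ (#A[p])^M` for any abelian group with `A[p]` finite;
* `exists_natCard_torsionBy_pow_le` — for a `p`-primary `A` with `A[p]` finite (cofinitely
  generated), `#A[p^M] ≤ D · p^{(corank A) M}` for a constant `D` (the order of `A` modulo its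
  maximal divisible subgroup `p^{k₀} A`);
* `le_zpCorank_of_pow_le_natCard_torsionBy` — conversely `p^{kM} ≤ C · #A[p^M]` for all `M` forces
  `k ≤ corank A`;
* `le_selmerCorank_of_pow_le_natCard` — the same for `A = Sel_{p^∞}(E/F)` (`p`-primary with finite
  `p`-torsion: `exists_pow_nsmul_eq_zero_galH1Primary`, `finite_torsionBy_selmerGroupPInfty`);
* `lowerBound_of_selmerGrowth` — in V2's currency: if one of `Sel_{2^∞}(E/ℚ)`,
  `Sel_{2^∞}(E^{(d)}/ℚ)` has `#(·)[2^M] ≥ 2^{(ν+1)M}/C` for all `M`, then `ν + 1 ≤ c ∨ ν + 1 ≤ c'`.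

So `stub_lowerBoundMinimalPosDepth` is REDUCED to the growth statement (Kolyvagin's triangular
system at `2`, the research content). HONEST FRAMING: nothing here touches Heegner points; BSD is
not proved; the stub itself stays open.

References: R. Greenberg, LNM 1716 (1999), §1 (cofinitely generated `ℤ_p`-modules);
V. A. Kolyvagin, Math. Ann. 291 (1991) 253–259, Thm. 2.2 (the subgroup `⊕ ℤ/M` generated by the
`η_i`). [folklore] algebra throughout.
-/

set_option autoImplicit false
-- the Theorems namespace of this sub repeats the summit name by design (D-0017 nested layout)
set_option linter.dupNamespace false

noncomputable section

open scoped Classical AddSubgroup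

open WeierstrassCurve Literature.NumberTheory.EllipticCurves

namespace Summit.BirchSwinnertonDyer.BirchSwinnertonDyer.Theorems.KolyvaginRankRigidity

section Algebra

variable {A : Type*} [AddCommGroup A] (p : ℕ)

/-- `#X = #ker φ · #im φ ≤ #Y' · #Z'` whenever `ker φ ↪ Y'`-many and `im φ ⊆ Z`: the counting
step `#A[p^{M+1}] ≤ #A[p] · #A[p^M]` along `x ↦ p • x`. [folklore] -/
theorem natCard_torsionBy_pow_succ_le [Finite A[(p : ℤ)]] (M : ℕ) :
    Nat.card A[((p ^ (M + 1) : ℕ) : ℤ)] ≤ Nat.card A[(p : ℤ)] * Nat.card A[((p ^ M : ℕ) : ℤ)] := by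
  haveI : Finite A[((p ^ M : ℕ) : ℤ)] := finite_torsionBy_pow A p M
  -- `ψ : A[p^{M+1}] → A[p^M]`, `x ↦ p • x`
  let ψ : A[((p ^ (M + 1) : ℕ) : ℤ)] →+ A[((p ^ M : ℕ) : ℤ)] :=
    ((nsmulAddMonoidHom p).comp (A[((p ^ (M + 1) : ℕ) : ℤ)]).subtype).codRestrict _ fun x ↦
      AddSubgroup.torsionBy.nsmul_iff.mpr (by
        change p ^ M • p • (x : A) = 0
        rw [smul_smul, ← pow_succ, ← AddSubgroupClass.coe_nsmul, AddSubgroup.torsionBy.nsmul x,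
          ZeroMemClass.coe_zero])
  rw [natCard_eq_card_ker_mul_card_range ψ]
  refine Nat.mul_le_mul ?_ ?_
  · -- `ker ψ ↪ A[p]`
    refine Nat.card_le_card_of_injective (fun x : ψ.ker ↦ (⟨((x : A[((p ^ (M + 1) : ℕ) : ℤ)]) : A),
        AddSubgroup.torsionBy.nsmul_iff.mpr ?_⟩ : A[(p : ℤ)])) ?_
    · have hx := x.2
      rw [AddMonoidHom.mem_ker] at hx
      exact congrArg (fun z : A[((p ^ M : ℕ) : ℤ)] ↦ (z : A)) hx
    · intro x y hxy
      exact Subtype.ext (Subtype.ext (congrArg (fun z : A[(p : ℤ)] ↦ (z : A)) hxy))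
  · exact Nat.card_le_card_of_injective ψ.range.subtype ψ.range.subtype_injective

/-- **`#A[p^M] ≤ (#A[p])^M`** for every abelian group with finite `p`-torsion (induction on `M`
along `0 → A[p] → A[p^{M+1}] → A[p^M]`). [folklore] -/
theorem natCard_torsionBy_pow_le_pow [Finite A[(p : ℤ)]] (M : ℕ) :
    Nat.card A[((p ^ M : ℕ) : ℤ)] ≤ Nat.card A[(p : ℤ)] ^ M := by
  induction M with
  | zero =>
    haveI : Subsingleton A[((p ^ 0 : ℕ) : ℤ)] := ⟨fun x y ↦ Subtype.ext (by
      have hx : p ^ 0 • (x : A) = 0 := AddSubgroup.torsionBy.nsmul_iff.mp x.2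
      have hy : p ^ 0 • (y : A) = 0 := AddSubgroup.torsionBy.nsmul_iff.mp y.2
      simp only [pow_zero, one_smul] at hx hy
      rw [hx, hy])⟩
    simp
  | succ M ih =>
    calc Nat.card A[((p ^ (M + 1) : ℕ) : ℤ)]
        ≤ Nat.card A[(p : ℤ)] * Nat.card A[((p ^ M : ℕ) : ℤ)] := natCard_torsionBy_pow_succ_le p M
      _ ≤ Nat.card A[(p : ℤ)] * Nat.card A[(p : ℤ)] ^ M := Nat.mul_le_mul_left _ ih
      _ = Nat.card A[(p : ℤ)] ^ (M + 1) := by rw [pow_succ, mul_comm]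

/-- Left exactness of `(-)[n]`: for a subgroup `C ≤ A` with `A/C` finite,
`#A[n] ≤ #C[n] · #(A/C)` (`0 → C[n] → A[n] → (A/C)[n]` and `(A/C)[n] ⊆ A/C`). [folklore] -/
theorem natCard_torsionBy_le_mul_of_addSubgroup (C : AddSubgroup A) [Finite (A ⧸ C)] (n : ℕ)
    [Finite C[(n : ℤ)]] : Nat.card A[(n : ℤ)] ≤ Nat.card C[(n : ℤ)] * Nat.card (A ⧸ C) := by
  have hi : Function.Injective C.subtype := C.subtype_injective
  have hex : ∀ a, QuotientAddGroup.mk' C a = 0 → a ∈ C.subtype.range := fun a ha ↦ by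
    rw [AddSubgroup.range_subtype]; exact (QuotientAddGroup.eq_zero_iff a).mp ha
  have hfi : ∀ d : C, QuotientAddGroup.mk' C (C.subtype d) = 0 := fun d ↦
    (QuotientAddGroup.eq_zero_iff _).mpr d.2
  rw [natCard_eq_card_ker_mul_card_range (torsionByMap (QuotientAddGroup.mk' C) n),
    ker_torsionByMap_eq_range hi hex hfi]
  refine Nat.mul_le_mul ?_ ?_
  · exact Nat.card_le_card_of_surjective _ (AddMonoidHom.rangeRestrict_surjective _)
  · haveI : Finite (A ⧸ C)[(n : ℤ)] := inferInstance
    exact Nat.card_le_card_of_injective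
      (fun z : (torsionByMap (QuotientAddGroup.mk' C) n).range ↦ ((z : (A ⧸ C)[(n : ℤ)]) : A ⧸ C))
      (fun z w h ↦ Subtype.ext (Subtype.ext h))

variable [hp : Fact p.Prime]

/-- **Growth of `A[p^M]` for a cofinitely generated `p`-primary group.** If `A` is `p`-primary
with `A[p]` finite, then `#A[p^M] ≤ D · p^{(corank_{ℤ_p} A) · M}` for all `M`, with
`D = #(A / p^{k₀} A)` where `p^{k₀} A` is the maximal divisible subgroup (stability index `k₀` of
the chain `A[p] ∩ p^k A`, `exists_torsionBy_inf_range_stable`; `#(p^{k₀}A)[p] = p^{corank}` is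
`pow_zpCorank_eq_natCard_torsionBy_inf_range_of_stable`). Greenberg, LNM 1716, §1
(`A ≅ (ℚ_p/ℤ_p)^r ⊕ (finite)`). [folklore] -/
theorem exists_natCard_torsionBy_pow_le (hA : ∀ a : A, ∃ n : ℕ, p ^ n • a = 0) [Finite A[(p : ℤ)]] :
    ∃ D : ℕ, 0 < D ∧ ∀ M : ℕ, Nat.card A[((p ^ M : ℕ) : ℤ)] ≤ D * p ^ (zpCorank A p * M) := by
  have hpp : p.Prime := hp.out
  obtain ⟨k₀, hst⟩ := exists_torsionBy_inf_range_stable (A := A) p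
  set C : AddSubgroup A := (nsmulAddMonoidHom (α := A) (p ^ k₀)).range with hC
  -- `C` is `p`-divisible
  have hdiv : ∀ c ∈ C, ∃ c' ∈ C, p • c' = c := fun c hc ↦ by
    obtain ⟨n, hn⟩ := hA c
    exact exists_nsmul_eq_of_stable p hst n c hc hn
  have hD : ∀ d : C, ∃ d' : C, p • d' = d := fun d ↦ by
    obtain ⟨d', hd', h⟩ := hdiv d d.2
    exact ⟨⟨d', hd'⟩, Subtype.ext h⟩
  -- the exact sequence `0 → C → A → A/C → 0`
  have hf : Function.Surjective (QuotientAddGroup.mk' C) := QuotientAddGroup.mk'_surjective C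
  have hex : ∀ a, QuotientAddGroup.mk' C a = 0 → a ∈ C.subtype.range := fun a ha ↦ by
    rw [AddSubgroup.range_subtype]; exact (QuotientAddGroup.eq_zero_iff a).mp ha
  have hfi : ∀ d : C, QuotientAddGroup.mk' C (C.subtype d) = 0 := fun d ↦
    (QuotientAddGroup.eq_zero_iff _).mpr d.2
  -- `A/C` is finite: `(A/C)[p]` is the image of `A[p]`, and `p^{k₀}` kills `A/C`
  haveI : Finite (A ⧸ C)[(p : ℤ)] :=
    Finite.of_surjective _ (torsionByMap_surjective (p := p) hf hex hfi hD)
  haveI hAC : Finite (A ⧸ C) := by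
    haveI := finite_torsionBy_pow (A ⧸ C) p k₀
    refine Finite.of_injective (fun z : A ⧸ C ↦ (⟨z, ?_⟩ : (A ⧸ C)[((p ^ k₀ : ℕ) : ℤ)]))
      (fun z w h ↦ congrArg Subtype.val h)
    induction z using QuotientAddGroup.induction_on with
    | H a =>
      rw [AddSubgroup.torsionBy.nsmul_iff, ← QuotientAddGroup.mk_nsmul, QuotientAddGroup.eq_zero_iff]
      exact ⟨a, rfl⟩
  -- `C[p]` is `A[p] ∩ C`, of order `p^{corank}`
  haveI : Finite ↥(A[(p : ℤ)] ⊓ C) :=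
    Finite.of_injective (AddSubgroup.inclusion (inf_le_left : A[(p : ℤ)] ⊓ C ≤ A[(p : ℤ)]))
      (AddSubgroup.inclusion_injective _)
  have h3 : Nat.card C[(p : ℤ)] = Nat.card ↥(A[(p : ℤ)] ⊓ C) := by
    refine Nat.card_congr (Equiv.ofBijective
      (fun x : C[(p : ℤ)] ↦ (⟨((x : C) : A), AddSubgroup.mem_inf.mpr ⟨?_, (x : C).2⟩⟩ :
        ↥(A[(p : ℤ)] ⊓ C))) ⟨?_, ?_⟩)
    · rw [AddSubgroup.torsionBy.nsmul_iff, ← AddSubgroupClass.coe_nsmul,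
        AddSubgroup.torsionBy.nsmul_iff.mp (x : C[(p : ℤ)]).2, ZeroMemClass.coe_zero]
    · intro x y hxy
      have h := congrArg Subtype.val hxy
      exact Subtype.ext (Subtype.ext h)
    · rintro ⟨a, ha⟩
      obtain ⟨ha₁, ha₂⟩ := AddSubgroup.mem_inf.mp ha
      refine ⟨⟨⟨a, ha₂⟩, AddSubgroup.torsionBy.nsmul_iff.mpr (Subtype.ext ?_)⟩, rfl⟩
      rw [AddSubgroupClass.coe_nsmul, ZeroMemClass.coe_zero]
      exact AddSubgroup.torsionBy.nsmul_iff.mp ha₁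
  haveI hCfin : Finite C[(p : ℤ)] :=
    Finite.of_injective (torsionByMap C.subtype p) (torsionByMap_injective C.subtype_injective p)
  have hr : p ^ zpCorank A p = Nat.card C[(p : ℤ)] := by
    rw [h3]; exact pow_zpCorank_eq_natCard_torsionBy_inf_range_of_stable p hA hst
  refine ⟨Nat.card (A ⧸ C), Nat.card_pos, fun M ↦ ?_⟩
  haveI : Finite C[((p ^ M : ℕ) : ℤ)] := finite_torsionBy_pow C p M
  calc Nat.card A[((p ^ M : ℕ) : ℤ)]
      ≤ Nat.card C[((p ^ M : ℕ) : ℤ)] * Nat.card (A ⧸ C) :=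
        natCard_torsionBy_le_mul_of_addSubgroup C (p ^ M)
    _ ≤ Nat.card C[(p : ℤ)] ^ M * Nat.card (A ⧸ C) :=
        Nat.mul_le_mul_right _ (natCard_torsionBy_pow_le_pow p M)
    _ = Nat.card (A ⧸ C) * p ^ (zpCorank A p * M) := by rw [pow_mul, hr, mul_comm]

/-- **Coranks from finite levels.** If `A` is `p`-primary with `A[p]` finite and
`p^{kM} ≤ C · #A[p^M]` for every level `M` (some constant `C`), then `k ≤ corank_{ℤ_p} A`.
(From `exists_natCard_torsionBy_pow_le`: `p^{kM} ≤ C D p^{rM}` for all `M` forces `k ≤ r`.)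
This is how Kolyvagin reads `r^{(f+1)} ≥ f + 1` off the subgroup `⊕_{i ≤ f+1} ℤ/M` generated
by his classes `η_i` (Math. Ann. 291, Thm. 2.2). [folklore] -/
theorem le_zpCorank_of_pow_le_natCard_torsionBy (hA : ∀ a : A, ∃ n : ℕ, p ^ n • a = 0)
    [Finite A[(p : ℤ)]] {k C₀ : ℕ}
    (h : ∀ M : ℕ, p ^ (k * M) ≤ C₀ * Nat.card A[((p ^ M : ℕ) : ℤ)]) : k ≤ zpCorank A p := by
  have hpp : p.Prime := hp.out
  obtain ⟨D, hD, hle⟩ := exists_natCard_torsionBy_pow_le p hA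
  set r := zpCorank A p with hr
  by_contra hk
  push Not at hk
  -- choose `M` with `C₀ * D < p ^ M`
  obtain ⟨M, hM⟩ : ∃ M : ℕ, C₀ * D < p ^ M := ⟨C₀ * D, Nat.lt_pow_self hpp.one_lt⟩
  have h1 : p ^ (k * M) ≤ C₀ * D * p ^ (r * M) := by
    calc p ^ (k * M) ≤ C₀ * Nat.card A[((p ^ M : ℕ) : ℤ)] := h M
      _ ≤ C₀ * (D * p ^ (r * M)) := Nat.mul_le_mul_left _ (hle M)
      _ = C₀ * D * p ^ (r * M) := by ring
  have h2 : C₀ * D * p ^ (r * M) < p ^ M * p ^ (r * M) :=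
    Nat.mul_lt_mul_of_pos_right hM (pow_pos hpp.pos _)
  have h3 : p ^ M * p ^ (r * M) ≤ p ^ (k * M) := by
    rw [← pow_add]
    exact Nat.pow_le_pow_right hpp.pos (by nlinarith)
  omega

end Algebra

/-! ## Selmer groups -/

section Selmer

variable {F : Type} [Field F] [NumberField F] (X : WeierstrassCurve F) [X.IsElliptic]
  (p : ℕ) [hp : Fact p.Prime]

/-- **Selmer coranks from finite levels.** If `p^{kM} ≤ C · #Sel_{p^∞}(E/F)[p^M]` for every `M`,
then `k ≤ corank_{ℤ_p} Sel_{p^∞}(E/F)` (`Sel_{p^∞}` is `p`-primary with finite `p`-torsion, so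
`le_zpCorank_of_pow_le_natCard_torsionBy` applies). Greenberg (1999), §1. [folklore] -/
theorem le_selmerCorank_of_pow_le_natCard {k C₀ : ℕ}
    (h : ∀ M : ℕ, p ^ (k * M) ≤ C₀ * Nat.card (selmerGroupPInfty X p)[((p ^ M : ℕ) : ℤ)]) :
    k ≤ X.selmerCorank p := by
  haveI : Finite (selmerGroupPInfty X p)[(p : ℤ)] := finite_torsionBy_selmerGroupPInfty X p
  have hA : ∀ a : selmerGroupPInfty X p, ∃ n : ℕ, p ^ n • a = 0 := fun a ↦ by
    obtain ⟨n, hn⟩ := exists_pow_nsmul_eq_zero_galH1Primary X p (a : galH1Primary X p)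
    exact ⟨n, Subtype.ext (by rw [AddSubmonoidClass.coe_nsmul, hn, ZeroMemClass.coe_zero])⟩
  exact le_zpCorank_of_pow_le_natCard_torsionBy p hA h

end Selmer

/-! ## In V2's currency -/

/-- **The terminal step of `stub_lowerBoundMinimalPosDepth` at `p = 2`.** If for one of the two
curves `V ∈ {E, E^{(d)}}` the `2^M`-torsion of `Sel_{2^∞}(V/ℚ)` grows at least like
`2^{(ν+1)M}/C` (this is what `ν + 1` Kolyvagin classes of level `2^M`, independent modulo a
bounded defect and lying in one `τ`-eigenline, provide — the research content of the stub), then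
`ν + 1 ≤ corank Sel_{2^∞}(E/ℚ) ∨ ν + 1 ≤ corank Sel_{2^∞}(E^{(d)}/ℚ)`. [folklore] -/
theorem lowerBound_of_selmerGrowth (W : WeierstrassCurve ℚ) [W.IsElliptic] (d : ℚ)
    [(W.quadraticTwist d).IsElliptic] (ν C₀ : ℕ)
    (h : (∀ M : ℕ, 2 ^ ((ν + 1) * M) ≤ C₀ * Nat.card (selmerGroupPInfty W 2)[((2 ^ M : ℕ) : ℤ)]) ∨
      (∀ M : ℕ, 2 ^ ((ν + 1) * M) ≤
        C₀ * Nat.card (selmerGroupPInfty (W.quadraticTwist d) 2)[((2 ^ M : ℕ) : ℤ)])) :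
    ν + 1 ≤ W.selmerCorank 2 ∨ ν + 1 ≤ (W.quadraticTwist d).selmerCorank 2 := by
  haveI : Fact (Nat.Prime 2) := ⟨Nat.prime_two⟩
  rcases h with h | h
  · exact Or.inl (le_selmerCorank_of_pow_le_natCard W 2 h)
  · exact Or.inr (le_selmerCorank_of_pow_le_natCard (W.quadraticTwist d) 2 h)


end Summit.BirchSwinnertonDyer.BirchSwinnertonDyer.Theorems.KolyvaginRankRigidity
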